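import Mathlib
import Summits.Ventures.HodgeRepro2.Tier7.Target
import Summits.Ventures.HodgeRepro2.Tier7.Line1.Defs
import Summits.Ventures.HodgeRepro2.Tier7.Line1.CupProduct
import Summits.Ventures.HodgeRepro2.Tier7.Line3.Defs
import Summits.Ventures.HodgeRepro2.Tier7.Datum.CurveTensorShadow
import Summits.Ventures.HodgeRepro2.Tier7.Datum.K7Half

/-!
# Tier7/Datum/AbelianShadow — THE NON-VACUITY DATUM `datumA` (clause (iii) of ruling (A′); t7-lead l. 14651 (B),
plan-1 l. 14811; t7-L1-p1)

A datum of the FROZEN structure `PeriodDatum` (Target.lean 6e511b88…) on which BOTH live lines' residuals HOLD, so that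
neither `∀ D, ¬ CommonIrred D` nor `∀ D, ¬ RtfConclusion D` is a theorem and the per-datum bridges have content:
the number-field half of `Datum/K7Half.lean` (`K = E′ = ℚ(ζ₇)`, the standard anisotropic hermitian 3-space, the parity
tetrahedron, the canonical eigenvectors `e i = eGen (σ i) i` — t7-crit-1's datum of record, credited), the shadow
`HXA = A ⊗ A'` of `Datum/CurveTensorShadow.lean` with `V = H¹(B, ℂ)` and the real structure `barM`,
`β(v, w) = λ₀(v)λ₁(w) + λ₂(v)λ₃(w)` built from dual functionals of the generators (so `β(e₀, e₁) = 1 = β(e₂, e₃)`),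
`G = Unit`, `alb v = v ⊗ 1`, `ω(μ_i) = ℂ·alb(e i)`.
DELIVERABLES (sorry-free; axioms propext / Classical.choice / Quot.sound): `datumA`; `concl_datumA : ∃ g,
⟨f^*Ω_s, f^*Ω_{s̄}⟩ ≠ 0` (the value is `1`); `commonIrred_datumA : Line1.CommonIrred datumA` (`W = W' = ℂ·(t ⊗ 1)`);
`rtfConclusion_datumA : Line3.RtfConclusion datumA` (`SeesawData` with `Rep = Unit`, `Θ = ℂ·(t ⊗ 1)`, `comp = projA`);
`orthDistinct_datumA` (the tower hypothesis, trivially); `finiteDimensional_datumA` (`H^{2,0}` is a line). What it is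
NOT: a model of the real surface — `G` is trivial and `H^{2,0}` is a line; it certifies SATISFIABILITY of the residuals,
nothing about (P). §8(d): NO. Author: t7-L1-p1 (prover-pub-hodge-repro2-t7-L1-p1-g0-0).
-/

/-! ## Part C (continued) — `β`, the datum `datumA`, the deliverables (t7-L1-p1) -/

namespace Summit.Ventures.HodgeRepro2.Tier7.DatumA

open Summit.Ventures.HodgeRepro2 Summit.Ventures.HodgeRepro2.T6 Summit.Ventures.HodgeRepro2.Tier7
  Summit.Ventures.HodgeRepro2.Tier7.Line1
open scoped TensorProduct

noncomputable section

/-! ### C.4 the bilinear form `β` with `β e₀ e₁ = 1 = β e₂ e₃` (dual functionals of the generators) -/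

/-- a functional on `K7 ⊗ ℂ` taking the value `1` on the generator `v σ` -/
theorem exists_dual_vGen (σ : K7 →+* ℂ) : ∃ ℓ : Module.Dual ℂ (KC K7), ℓ (A1EigenGen.vGen K7 σ) = 1 := by
  have hne := A1EigenGen.vGen_ne_zero K7 σ
  have h := (Module.forall_dual_apply_eq_zero_iff ℂ (A1EigenGen.vGen K7 σ)).not.2 hne
  push Not at h
  obtain ⟨φ, hφ⟩ := h
  refine ⟨(φ (A1EigenGen.vGen K7 σ))⁻¹ • φ, ?_⟩
  rw [LinearMap.smul_apply, smul_eq_mul, inv_mul_cancel₀ hφ]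

/-- the chosen functional -/
def dualV (σ : K7 →+* ℂ) : Module.Dual ℂ (KC K7) := Classical.choose (exists_dual_vGen σ)

/-- the chosen functional takes the value `1` on `v σ` -/
theorem dualV_vGen (σ : K7 →+* ℂ) : dualV σ (A1EigenGen.vGen K7 σ) = 1 := Classical.choose_spec (exists_dual_vGen σ)

/-- `λ i : H¹(B, ℂ) → ℂ`, the `i`-th coordinate composed with the dual functional of `v (σ i)` -/
def lam (i : Fin 4) : H1C K7 →ₗ[ℂ] ℂ := (dualV (sigma i)).comp (LinearMap.proj i)

/-- `λ i (e i) = 1` -/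
theorem lam_eJ_self (i : Fin 4) : lam i (eJ i) = 1 := by
  simp only [lam, LinearMap.comp_apply, LinearMap.proj_apply, eJ_apply_self, dualV_vGen]

/-- `λ j (e i) = 0` for `j ≠ i` -/
theorem lam_eJ_ne (i j : Fin 4) (h : j ≠ i) : lam j (eJ i) = 0 := by
  simp only [lam, LinearMap.comp_apply, LinearMap.proj_apply, eJ_apply_ne i j h, map_zero]

/-- `β(v, w) = λ₀(v) λ₁(w) + λ₂(v) λ₃(w)` -/
def betaK7 : H1C K7 →ₗ[ℂ] H1C K7 →ₗ[ℂ] ℂ :=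
  (LinearMap.mul ℂ ℂ).compl₁₂ (lam 0) (lam 1) + (LinearMap.mul ℂ ℂ).compl₁₂ (lam 2) (lam 3)

/-- the value of `β` -/
theorem betaK7_apply (v w : H1C K7) : betaK7 v w = lam 0 v * lam 1 w + lam 2 v * lam 3 w := by
  simp [betaK7]

/-- `β(e₀, e₁) = 1` -/
theorem betaK7_e0_e1 : betaK7 (eJ 0) (eJ 1) = 1 := by
  rw [betaK7_apply, lam_eJ_self, lam_eJ_self, lam_eJ_ne 0 2 (by decide), lam_eJ_ne 1 3 (by decide)]
  ring

/-- `β(e₂, e₃) = 1` -/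
theorem betaK7_e2_e3 : betaK7 (eJ 2) (eJ 3) = 1 := by
  rw [betaK7_apply, lam_eJ_self, lam_eJ_self, lam_eJ_ne 2 0 (by decide), lam_eJ_ne 3 1 (by decide)]
  ring

/-- `β` takes the value `1` -/
theorem betaK7_one : ∃ v w, betaK7 v w = 1 := ⟨eJ 0, eJ 1, betaK7_e0_e1⟩

/-! ### C.5 the datum -/

/-- the carrier `HXA` of the datum -/
abbrev HXK7 := HXA realStrK7 betaK7

/-- the shadow -/
def shadowK7 : SurfaceShadow HXK7 Unit := shadowA realStrK7 betaK7 betaK7_one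

/-- `alb` -/
def albK7 : H1C K7 →ₗ[ℂ] HXK7 := albA realStrK7 betaK7

/-- `alb (e i) ≠ 0` -/
theorem albK7_eJ_ne_zero (i : Fin 4) : albK7 (eJ i) ≠ 0 := by
  intro h
  have := albA_injective realStrK7 betaK7 (h.trans (map_zero _).symm)
  exact eJ_ne_zero i this

/-- **THE NON-VACUITY DATUM** `datumA` (t7-lead l. 14651 (B), clause (iii) of ruling (A′)): the frozen structure
`PeriodDatum` with `K = E′ = ℚ(ζ₇)`, the standard anisotropic hermitian 3-space, the abelian-surface shadow
`HXA = A ⊗ A'` with `G = Unit`, `alb = (v ↦ v ⊗ 1)`, the parity tetrahedron, the canonical eigenvectors, and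
`ω(μ_i) = ℂ · alb(e i)`. -/
def datumA : PeriodDatum K7 K7 (Fin 3 → K7) HXK7 Unit where
  E := cmK7
  Vh := hermK7
  S := shadowK7
  F := faceJ
  alb := albK7
  alb_inj := albA_injective realStrK7 betaK7
  alb_h10 := fun v _ => LinearMap.mem_range_self _ v
  s := sJ
  hs0 := sJ_mem0
  hs1 := sJ_mem1
  hs2 := sbar_mem2
  hs3 := sbar_mem3
  e := eJ
  e0_mem := A1EigenGen.eGen_mem K7 sJ 0
  e1_mem := A1EigenGen.eGen_mem K7 sJ 1
  e2_mem := A1EigenGen.eGen_mem K7 _ 2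
  e3_mem := A1EigenGen.eGen_mem K7 _ 3
  e_ne := eJ_ne_zero
  omega := fun i => Submodule.span ℂ {albK7 (eJ i)}
  omega_le := by
    intro i
    rw [Submodule.span_le, Set.singleton_subset_iff]
    exact LinearMap.mem_range_self _ _
  omega_irred := fun i => heckeIrred_span_singleton_unit (albK7_eJ_ne_zero i)
  theta_mem := fun i => Submodule.mem_span_singleton_self _
  center_scalar := fun _ _ _ => ⟨1, fun a _ => by show a = (1 : ℂ) • a; rw [one_smul]⟩
  center_match := fun _ _ _ _ => rfl
  disc := fun _ => 1
  disc_plus := fun _ => map_one conjK7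
  disc_ne := fun _ => one_ne_zero
  disc_match := ⟨1, one_ne_zero, by simp⟩

/-! ### C.6 the deliverables -/

/-- the wedge `θ(μ_0) ∧ θ(μ_1)` of the datum (translates trivial) is the generator `t ⊗ 1` -/
theorem fOmegaS_datumA (g : Fin 4 → Unit) : datumA.fOmegaS g = tt realStrK7 betaK7 := by
  show albK7 (eJ 0) * albK7 (eJ 1) = _
  rw [albK7, albA_mul_albA, betaK7_e0_e1, one_smul]

/-- the wedge `θ(μ_2) ∧ θ(μ_3)` of the datum is the generator `t ⊗ 1` -/
theorem fOmegaSbar_datumA (g : Fin 4 → Unit) : datumA.fOmegaSbar g = tt realStrK7 betaK7 := by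
  show albK7 (eJ 2) * albK7 (eJ 3) = _
  rw [albK7, albA_mul_albA, betaK7_e2_e3, one_smul]

/-- **clause (iii), the conclusion holds in `datumA`**: `⟨f^*Ω_s, f^*Ω_{s̄}⟩ = 1` -/
theorem concl_datumA : ∃ g : Fin 4 → Unit, datumA.S.L2 (datumA.fOmegaS g) (datumA.fOmegaSbar g) ≠ 0 := by
  refine ⟨fun _ => (), ?_⟩
  rw [fOmegaS_datumA, fOmegaSbar_datumA]
  show intA realStrK7 betaK7 (tt realStrK7 betaK7 * barA realStrK7 betaK7 (tt realStrK7 betaK7)) ≠ 0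
  rw [intA_tt_mul_barA_tt]
  exact one_ne_zero

/-- the line lies in `P_A` -/
theorem lineA_le_prodModS : lineA realStrK7 betaK7 ≤ prodModS datumA := by
  rw [lineA, Submodule.span_singleton_le_iff_mem]
  exact Submodule.subset_span ⟨fun _ => (), fOmegaS_datumA _⟩

/-- the line lies in `P_A` -/
theorem lineA_le_prodModSbar : lineA realStrK7 betaK7 ≤ prodModSbar datumA := by
  rw [lineA, Submodule.span_singleton_le_iff_mem]
  exact Submodule.subset_span ⟨fun _ => (), fOmegaSbar_datumA _⟩

/-- **LINE 1's residual is SATISFIABLE**: `CommonIrred datumA` (`W = W' = ℂ · (t ⊗ 1)`) -/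
theorem commonIrred_datumA : CommonIrred datumA :=
  commonIrred_of_irred_le_inf datumA _ (heckeIrred_span_singleton_unit (tt_ne_zero _ _))
    lineA_le_prodModS lineA_le_prodModSbar

/-- the projection of `HXA` onto the line `ℂ · (t ⊗ 1)`: `x ↦ ∫(x · (1 ⊗ t')) · (t ⊗ 1)` -/
def projA : HXK7 →ₗ[ℂ] HXK7 :=
  LinearMap.smulRight ((intA realStrK7 betaK7).comp
    (LinearMap.mulRight ℂ ((1 : Ahol betaK7) ⊗ₜ[ℂ] (CurveAlg.t : Aanti realStrK7 betaK7)))) (tt realStrK7 betaK7)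

/-- unfolding `projA` -/
theorem projA_apply (x : HXK7) :
    projA x = intA realStrK7 betaK7 (x * ((1 : Ahol betaK7) ⊗ₜ[ℂ] (CurveAlg.t : Aanti realStrK7 betaK7))) •
      tt realStrK7 betaK7 := rfl

/-- `projA` fixes the generator -/
theorem projA_tt : projA (tt realStrK7 betaK7) = tt realStrK7 betaK7 := by
  rw [projA_apply, tt, Algebra.TensorProduct.tmul_mul_tmul, mul_one, one_mul, intA_tmul]
  simp

/-- `projA` lands in the line -/
theorem projA_mem (x : HXK7) : projA x ∈ lineA realStrK7 betaK7 :=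
  Submodule.smul_mem _ _ (tt_mem_lineA _ _)

/-- the `SeesawData` of Line 3 on `datumA`: one constituent, `Θ = ℂ · (t ⊗ 1)`, `comp = projA` -/
def seesawDataA : Line3.SeesawData datumA where
  Rep := Unit
  Θ := fun _ => lineA realStrK7 betaK7
  comp := fun _ => projA
  Θ_le := fun _ => by
    show lineA realStrK7 betaK7 ≤ H10A realStrK7 betaK7 * H10A realStrK7 betaK7
    rw [H10A_mul_H10A realStrK7 betaK7 betaK7_one]
  Θ_irred := fun _ _ => heckeIrred_span_singleton_unit (tt_ne_zero _ _)
  comp_mem := fun _ x => projA_mem x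
  comp_act := fun _ _ _ => rfl
  comp_preserves := by
    intro _ U hU _ x hx
    have hU' : U ≤ lineA realStrK7 betaK7 := by
      rw [← H10A_mul_H10A realStrK7 betaK7 betaK7_one]; exact hU
    rcases eq_bot_or_eq_span_of_le_span hU' with h | h
    · subst h
      rw [Submodule.mem_bot] at hx ⊢
      rw [hx, map_zero]
    · subst h
      exact projA_mem x

/-- **LINE 3's residual is SATISFIABLE**: `RtfConclusion datumA` -/
theorem rtfConclusion_datumA : Line3.RtfConclusion datumA := by
  refine ⟨seesawDataA, (), ⟨fun _ => (), ?_⟩, ⟨fun _ => (), ?_⟩⟩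
  · show projA (datumA.fOmegaS fun _ => ()) ≠ 0
    rw [fOmegaS_datumA, projA_tt]
    exact tt_ne_zero _ _
  · show projA (datumA.fOmegaSbar fun _ => ()) ≠ 0
    rw [fOmegaSbar_datumA, projA_tt]
    exact tt_ne_zero _ _

/-- the tower hypothesis holds (trivially) in `datumA`: `H^{1,0} ∧ H^{1,0}` is a line -/
theorem orthDistinct_datumA : OrthDistinct datumA := by
  intro W W' hW hW' hle hle' hne
  exfalso
  apply hne
  have h1 : W ≤ lineA realStrK7 betaK7 := by
    rw [← H10A_mul_H10A realStrK7 betaK7 betaK7_one]; exact hle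
  have h2 : W' ≤ lineA realStrK7 betaK7 := by
    rw [← H10A_mul_H10A realStrK7 betaK7 betaK7_one]; exact hle'
  rw [eq_span_of_irred_le_span hW h1, eq_span_of_irred_le_span hW' h2]

/-- `H^{1,0} ∧ H^{1,0}` of `datumA` is finite-dimensional (a line): t7-L1-p5's converse applies to it -/
theorem finiteDimensional_datumA : FiniteDimensional ℂ (datumA.S.H10 * datumA.S.H10) := by
  show FiniteDimensional ℂ (H10A realStrK7 betaK7 * H10A realStrK7 betaK7)
  rw [H10A_mul_H10A realStrK7 betaK7 betaK7_one]
  exact FiniteDimensional.span_singleton ℂ _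

end

end Summit.Ventures.HodgeRepro2.Tier7.DatumA
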